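import Summits.QuantumFields.YangMills.Theorems.SmallCircleAnchorAnchorGapStubDebyeScreening18

/-!
# Crux `AnchorGap` (stmt-QuantumFields-11141), line `registered` — stub SMOOTH, part 1: the Gaussian
# integral is differentiable in the precision matrix

Generic finite-dimensional Gaussian calculus for the registered stub `stub_gaussianIntegralSmooth`
(proved in `SmallCircleAnchorAnchorGapGaussianIntegralSmooth.lean`): for a measurable `H` of
polynomial growth, `P ↦ ∫ H(φ) e^{−½ φᵀ(Matrix.of P)φ} dφ` has a Fréchet derivative in the matrix
variable at every COERCIVE `P₀` (`c Σφᵢ² ≤ φᵀP₀φ`, `c > 0`).  [folklore]; no definition (the quadratic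
form as a continuous linear form in the matrix is an ∃-package), no named fact; the domination is the
tree's `integrable_polyGrowth_mul_gaussian` / `posDef_coercive` (`…StubDebyeScreening18`).

* §1 `abs_quadForm_sub_le` (the form is Lipschitz in the sup norm, constant `|ι|² Σφᵢ²`),
  `exists_quadCLM` (`Q φ P = φᵀPφ`, `‖Q φ‖ ≤ Σ|φ_a||φ_b|`, `Q` continuous), `coercive_of_mem_ball`
  (uniform coercivity `(c/2)Σφᵢ²` on the ball of radius `c / (2(|ι|²+1))`), `isOpen_coercive`,
  `posDef_subset_coercive`;
* §2 `integrable_of_coercive` — `H e^{−½φᵀPφ}` is integrable for coercive `P`;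
* §3 `hasFDerivAt_integrand`, `hasFDerivAt_gaussInt` — differentiation under the integral sign
  (`hasFDerivAt_integral_of_dominated_of_fderiv_le`), derivative `∫ (H e^{−½φᵀP₀φ} · (−½)) • Q φ`.
-/

set_option autoImplicit false

noncomputable section

namespace Summit.QuantumFields.YangMills.Theorems.AnchorGap

namespace GaussSmooth

open MeasureTheory Finset Matrix Filter Metric
open scoped Topology

variable {ι : Type} [Fintype ι]

/-! ### §1 The quadratic form in the matrix variable -/

/-- Entries are bounded by the sup norm: `|P a b| ≤ ‖P‖`. [folklore] -/
theorem abs_entry_le_norm (P : ι → ι → ℝ) (a b : ι) : |P a b| ≤ ‖P‖ :=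
  (Real.norm_eq_abs _).symm.trans_le ((norm_le_pi_norm (P a) b).trans (norm_le_pi_norm P a))

/-- `|φᵀDφ| ≤ (Σ_{ab} |D_{ab}|) Σᵢ φᵢ²` for the matrix `Matrix.of D`. [folklore] -/
theorem abs_quadForm_le_sum_entries (D : ι → ι → ℝ) (φ : ι → ℝ) :
    |φ ⬝ᵥ (Matrix.of D *ᵥ φ)| ≤ (∑ p, ∑ q, |D p q|) * ∑ i, φ i ^ 2 := by
  have hs : ∀ j, φ j ^ 2 ≤ ∑ i, φ i ^ 2 := fun j =>
    Finset.single_le_sum (f := fun i => φ i ^ 2) (fun i _ => sq_nonneg _) (Finset.mem_univ j)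
  have hprod : ∀ p q, |φ p| * |φ q| ≤ ∑ i, φ i ^ 2 := fun p q => by
    have h2 : 2 * (|φ p| * |φ q|) ≤ φ p ^ 2 + φ q ^ 2 := by
      nlinarith [sq_nonneg (|φ p| - |φ q|), sq_abs (φ p), sq_abs (φ q)]
    nlinarith [hs p, hs q, abs_nonneg (φ p), abs_nonneg (φ q)]
  have hexp : φ ⬝ᵥ (Matrix.of D *ᵥ φ) = ∑ p, ∑ q, D p q * (φ p * φ q) := by
    simp only [dotProduct, Matrix.mulVec, Matrix.of_apply, Finset.mul_sum]
    exact Finset.sum_congr rfl fun p _ => Finset.sum_congr rfl fun q _ => by ring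
  rw [hexp, Finset.sum_mul]
  refine (Finset.abs_sum_le_sum_abs _ _).trans (Finset.sum_le_sum fun p _ => ?_)
  rw [Finset.sum_mul]
  refine (Finset.abs_sum_le_sum_abs _ _).trans (Finset.sum_le_sum fun q _ => ?_)
  rw [abs_mul, abs_mul]
  exact mul_le_mul_of_nonneg_left (hprod p q) (abs_nonneg _)

/-- The quadratic form is Lipschitz in the matrix (sup norm):
`|φᵀPφ − φᵀP₀φ| ≤ |ι|² ‖P − P₀‖ Σᵢ φᵢ²`. [folklore] -/
theorem abs_quadForm_sub_le (P P₀ : ι → ι → ℝ) (φ : ι → ℝ) :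
    |φ ⬝ᵥ (Matrix.of P *ᵥ φ) - φ ⬝ᵥ (Matrix.of P₀ *ᵥ φ)|
      ≤ (Fintype.card ι : ℝ) ^ 2 * ‖P - P₀‖ * ∑ i, φ i ^ 2 := by
  have hsub : φ ⬝ᵥ (Matrix.of P *ᵥ φ) - φ ⬝ᵥ (Matrix.of P₀ *ᵥ φ)
      = φ ⬝ᵥ (Matrix.of (P - P₀) *ᵥ φ) := by
    rw [← dotProduct_sub, ← Matrix.sub_mulVec]; rfl
  rw [hsub]
  refine (abs_quadForm_le_sum_entries (P - P₀) φ).trans (mul_le_mul_of_nonneg_right ?_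
    (Finset.sum_nonneg fun i _ => sq_nonneg _))
  calc ∑ p, ∑ q, |(P - P₀) p q| ≤ ∑ _p : ι, ∑ _q : ι, ‖P - P₀‖ :=
        Finset.sum_le_sum fun p _ => Finset.sum_le_sum fun q _ => abs_entry_le_norm (P - P₀) p q
    _ = (Fintype.card ι : ℝ) ^ 2 * ‖P - P₀‖ := by
        rw [Finset.sum_const, Finset.sum_const, Finset.card_univ, nsmul_eq_mul, nsmul_eq_mul]; ring

/-- **The quadratic form as a continuous linear form in the matrix** (an ∃-package keeps the file
free of definitions): there is a continuous `Q : (ι → ℝ) → ((ι → ι → ℝ) →L[ℝ] ℝ)` with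
`Q φ P = φᵀ(Matrix.of P)φ` and `‖Q φ‖ ≤ Σ_{ab} |φ_a||φ_b|`. [folklore] -/
theorem exists_quadCLM (ι : Type) [Fintype ι] :
    ∃ Q : (ι → ℝ) → ((ι → ι → ℝ) →L[ℝ] ℝ),
      (∀ φ P, Q φ P = φ ⬝ᵥ (Matrix.of P *ᵥ φ)) ∧ (∀ φ, ‖Q φ‖ ≤ ∑ a, ∑ b, |φ a| * |φ b|) ∧
        Continuous Q := by
  let E : ι → ι → ((ι → ι → ℝ) →L[ℝ] ℝ) := fun a b =>
    (ContinuousLinearMap.proj b).comp (ContinuousLinearMap.proj (R := ℝ) (φ := fun _ : ι => ι → ℝ) a)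
  have hE : ∀ a b P, E a b P = P a b := fun a b P => rfl
  have hEn : ∀ a b, ‖E a b‖ ≤ 1 := fun a b =>
    ContinuousLinearMap.opNorm_le_bound _ zero_le_one fun P => by
      rw [hE, one_mul]; exact (norm_le_pi_norm (P a) b).trans (norm_le_pi_norm P a)
  refine ⟨fun φ => ∑ a, ∑ b, (φ a * φ b) • E a b, fun φ P => ?_, fun φ => ?_, ?_⟩
  · simp only [FunLike.coe_sum, FunLike.coe_smul, Finset.sum_apply, Pi.smul_apply, hE, smul_eq_mul,
      dotProduct, Matrix.mulVec, Matrix.of_apply, Finset.mul_sum]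
    exact Finset.sum_congr rfl fun a _ => Finset.sum_congr rfl fun b _ => by ring
  · refine (norm_sum_le _ _).trans (Finset.sum_le_sum fun a _ => ?_)
    refine (norm_sum_le _ _).trans (Finset.sum_le_sum fun b _ => ?_)
    rw [norm_smul, Real.norm_eq_abs, abs_mul]
    exact mul_le_of_le_one_right (by positivity) (hEn a b)
  · refine continuous_finsetSum _ fun a _ => continuous_finsetSum _ fun b _ => ?_
    exact (((continuous_apply a).mul (continuous_apply b)).smul continuous_const)

/-- The scalar matrix `c • 1`, `c > 0`, is positive definite with form `c Σᵢ φᵢ²` (here as the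
matrix `Matrix.of` of the function `fun a b => if a = b then c else 0`-free form `c • 1`). [folklore] -/
theorem smul_one_posDef_and_form [DecidableEq ι] {c : ℝ} (hc : 0 < c) :
    (c • (1 : Matrix ι ι ℝ)).PosDef ∧ ∀ φ : ι → ℝ, φ ⬝ᵥ ((c • (1 : Matrix ι ι ℝ)) *ᵥ φ) = c * ∑ i, φ i ^ 2 := by
  have hform : ∀ φ : ι → ℝ, φ ⬝ᵥ ((c • (1 : Matrix ι ι ℝ)) *ᵥ φ) = c * ∑ i, φ i ^ 2 := fun φ => by
    rw [Matrix.smul_mulVec, Matrix.one_mulVec, dotProduct_smul, smul_eq_mul, dotProduct]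
    congr 1
    exact Finset.sum_congr rfl fun i _ => by ring
  refine ⟨Matrix.PosDef.of_dotProduct_mulVec_pos ?_ fun φ hφ => ?_, hform⟩
  · exact Matrix.isHermitian_iff_isSymm.2 (by unfold Matrix.IsSymm; simp)
  · simp only [star_trivial]
    rw [hform φ]
    obtain ⟨i, hi⟩ : ∃ i, φ i ≠ 0 := Function.ne_iff.1 hφ
    have : 0 < ∑ j, φ j ^ 2 := lt_of_lt_of_le (by positivity : 0 < φ i ^ 2)
      (Finset.single_le_sum (f := fun j => φ j ^ 2) (fun j _ => sq_nonneg _) (Finset.mem_univ i))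
    positivity

/-- **Uniform coercivity near a coercive matrix.** If `c Σφᵢ² ≤ φᵀP₀φ` with `c > 0` then on the
sup-norm ball of radius `c / (2 (|ι|² + 1))` around `P₀` every matrix satisfies
`(c/2) Σφᵢ² ≤ φᵀPφ`. [folklore] -/
theorem coercive_of_mem_ball {c : ℝ} (hc : 0 < c) {P₀ : ι → ι → ℝ}
    (hP₀ : ∀ φ : ι → ℝ, c * ∑ i, φ i ^ 2 ≤ φ ⬝ᵥ (Matrix.of P₀ *ᵥ φ)) {P : ι → ι → ℝ}
    (hP : P ∈ ball P₀ (c / (2 * ((Fintype.card ι : ℝ) ^ 2 + 1)))) (φ : ι → ℝ) :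
    c / 2 * ∑ i, φ i ^ 2 ≤ φ ⬝ᵥ (Matrix.of P *ᵥ φ) := by
  have hs : 0 ≤ ∑ i, φ i ^ 2 := Finset.sum_nonneg fun i _ => sq_nonneg _
  have hd : ‖P - P₀‖ < c / (2 * ((Fintype.card ι : ℝ) ^ 2 + 1)) := by
    rw [← dist_eq_norm]; exact mem_ball.1 hP
  have hk : 0 ≤ (Fintype.card ι : ℝ) ^ 2 := sq_nonneg _
  have h1 := abs_quadForm_sub_le P P₀ φ
  have h2 : (Fintype.card ι : ℝ) ^ 2 * ‖P - P₀‖ ≤ c / 2 := by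
    have : (Fintype.card ι : ℝ) ^ 2 * ‖P - P₀‖
        ≤ (Fintype.card ι : ℝ) ^ 2 * (c / (2 * ((Fintype.card ι : ℝ) ^ 2 + 1))) :=
      mul_le_mul_of_nonneg_left hd.le hk
    refine this.trans ?_
    have hle : (Fintype.card ι : ℝ) ^ 2 / ((Fintype.card ι : ℝ) ^ 2 + 1) ≤ 1 :=
      div_le_one_of_le₀ (by linarith) (by positivity)
    calc (Fintype.card ι : ℝ) ^ 2 * (c / (2 * ((Fintype.card ι : ℝ) ^ 2 + 1)))
        = c / 2 * ((Fintype.card ι : ℝ) ^ 2 / ((Fintype.card ι : ℝ) ^ 2 + 1)) := by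
          field_simp
      _ ≤ c / 2 * 1 := mul_le_mul_of_nonneg_left hle (by positivity)
      _ = c / 2 := mul_one _
  have h3 : |φ ⬝ᵥ (Matrix.of P *ᵥ φ) - φ ⬝ᵥ (Matrix.of P₀ *ᵥ φ)| ≤ c / 2 * ∑ i, φ i ^ 2 :=
    h1.trans (mul_le_mul_of_nonneg_right h2 hs)
  have h4 := hP₀ φ
  have h5 := (abs_le.1 h3).1
  linarith

/-- **The coercive matrices form an open set** containing the positive definite ones.
[folklore] -/
theorem isOpen_coercive :
    IsOpen {P : ι → ι → ℝ | ∃ c : ℝ, 0 < c ∧ ∀ φ : ι → ℝ, c * ∑ i, φ i ^ 2 ≤ φ ⬝ᵥ (Matrix.of P *ᵥ φ)} := by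
  refine Metric.isOpen_iff.2 fun P₀ hP₀ => ?_
  obtain ⟨c, hc, hcoer⟩ := hP₀
  exact ⟨c / (2 * ((Fintype.card ι : ℝ) ^ 2 + 1)), by positivity,
    fun P hP => ⟨c / 2, by positivity, coercive_of_mem_ball hc hcoer hP⟩⟩

/-- Positive definite matrices are coercive (`posDef_coercive`). [folklore] -/
theorem posDef_subset_coercive :
    {P : ι → ι → ℝ | (Matrix.of P).PosDef}
      ⊆ {P : ι → ι → ℝ | ∃ c : ℝ, 0 < c ∧ ∀ φ : ι → ℝ, c * ∑ i, φ i ^ 2 ≤ φ ⬝ᵥ (Matrix.of P *ᵥ φ)} :=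
  fun P hP => posDef_coercive ι (Matrix.of P) hP

/-! ### §2 Integrability against a coercive Gaussian weight -/

/-- The constant of a polynomial-growth bound is nonnegative. [folklore] -/
theorem nonneg_of_polyBound {m : ℕ} {K : ℝ} {H : (ι → ℝ) → ℝ}
    (hb : ∀ φ : ι → ℝ, |H φ| ≤ K * (1 + ∑ i, φ i ^ 2) ^ m) : 0 ≤ K := by
  have h := hb 0
  simp only [Pi.zero_apply, ne_eq, OfNat.ofNat_ne_zero, not_false_eq_true, zero_pow, sum_const_zero,
    add_zero, one_pow, mul_one] at h
  exact (abs_nonneg _).trans h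

/-- **Integrability against a coercive Gaussian weight**: if `c Σφᵢ² ≤ φᵀPφ` (`c > 0`) and `H` is
measurable with `|H| ≤ K (1 + Σφᵢ²)^m`, then `H e^{−½φᵀPφ}` is integrable — domination by the
scalar Gaussian `e^{−½ c Σφᵢ²}` and the tree's `integrable_polyGrowth_mul_gaussian`. [folklore] -/
theorem integrable_of_coercive [DecidableEq ι] {c : ℝ} (hc : 0 < c) {P : ι → ι → ℝ}
    (hP : ∀ φ : ι → ℝ, c * ∑ i, φ i ^ 2 ≤ φ ⬝ᵥ (Matrix.of P *ᵥ φ)) {m : ℕ} {K : ℝ}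
    {H : (ι → ℝ) → ℝ} (hHm : Measurable H) (hHb : ∀ φ : ι → ℝ, |H φ| ≤ K * (1 + ∑ i, φ i ^ 2) ^ m) :
    Integrable (fun φ : ι → ℝ => H φ * Real.exp (-(φ ⬝ᵥ (Matrix.of P *ᵥ φ)) / 2)) := by
  obtain ⟨hpd, hform⟩ := smul_one_posDef_and_form (ι := ι) hc
  have hmaj := integrable_polyGrowth_mul_gaussian ι (c • (1 : Matrix ι ι ℝ)) hpd m K (fun φ => |H φ|)
    hHm.abs.aestronglyMeasurable (fun φ => by rw [abs_abs]; exact hHb φ)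
  refine hmaj.mono' ?_ (Filter.Eventually.of_forall fun φ => ?_)
  · exact (hHm.mul ((continuous_id.dotProduct
      (Continuous.matrix_mulVec continuous_const continuous_id)).neg.div_const _).rexp.measurable).aestronglyMeasurable
  · rw [Real.norm_eq_abs, abs_mul, Real.abs_exp, hform]
    refine mul_le_mul_of_nonneg_left (Real.exp_le_exp.2 ?_) (abs_nonneg _)
    have := hP φ
    rw [neg_div, neg_div, neg_le_neg_iff]
    exact div_le_div_of_nonneg_right this (by norm_num)

/-! ### §3 Differentiation under the integral sign in the matrix variable -/

/-- `Σ_a Σ_b |φ_a| |φ_b| ≤ |ι|² (1 + Σᵢ φᵢ²)`. [folklore] -/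
theorem sum_abs_mul_abs_le (φ : ι → ℝ) :
    ∑ a, ∑ b, |φ a| * |φ b| ≤ (Fintype.card ι : ℝ) ^ 2 * (1 + ∑ i, φ i ^ 2) := by
  have hs : ∀ j, φ j ^ 2 ≤ ∑ i, φ i ^ 2 := fun j =>
    Finset.single_le_sum (f := fun i => φ i ^ 2) (fun i _ => sq_nonneg _) (Finset.mem_univ j)
  have hprod : ∀ a b, |φ a| * |φ b| ≤ ∑ i, φ i ^ 2 := fun a b => by
    have h2 : 2 * (|φ a| * |φ b|) ≤ φ a ^ 2 + φ b ^ 2 := by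
      nlinarith [sq_nonneg (|φ a| - |φ b|), sq_abs (φ a), sq_abs (φ b)]
    nlinarith [hs a, hs b, abs_nonneg (φ a), abs_nonneg (φ b)]
  have hS : 0 ≤ ∑ i, φ i ^ 2 := Finset.sum_nonneg fun i _ => sq_nonneg _
  calc ∑ a, ∑ b, |φ a| * |φ b| ≤ ∑ _a : ι, ∑ _b : ι, ∑ i, φ i ^ 2 :=
        Finset.sum_le_sum fun a _ => Finset.sum_le_sum fun b _ => hprod a b
    _ = (Fintype.card ι : ℝ) ^ 2 * ∑ i, φ i ^ 2 := by
        rw [Finset.sum_const, Finset.sum_const, Finset.card_univ, nsmul_eq_mul, nsmul_eq_mul]; ring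
    _ ≤ (Fintype.card ι : ℝ) ^ 2 * (1 + ∑ i, φ i ^ 2) := by nlinarith [sq_nonneg (Fintype.card ι : ℝ)]

/-- The integrand `P ↦ H(φ) e^{−½ φᵀPφ}` has, for fixed `φ`, the Fréchet derivative
`(H(φ) e^{−½ φᵀPφ} · (−½)) • Q φ` in the matrix (`Q φ` the form `P ↦ φᵀPφ`). [folklore] -/
theorem hasFDerivAt_integrand {Q : (ι → ℝ) → ((ι → ι → ℝ) →L[ℝ] ℝ)}
    (hQ : ∀ φ P, Q φ P = φ ⬝ᵥ (Matrix.of P *ᵥ φ)) (H : (ι → ℝ) → ℝ) (φ : ι → ℝ) (P : ι → ι → ℝ) :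
    HasFDerivAt (fun P : ι → ι → ℝ => H φ * Real.exp (-(φ ⬝ᵥ (Matrix.of P *ᵥ φ)) / 2))
      ((H φ * Real.exp (-(φ ⬝ᵥ (Matrix.of P *ᵥ φ)) / 2) * (-(1 / 2) : ℝ)) • Q φ) P := by
  have hfun : (fun P : ι → ι → ℝ => H φ * Real.exp (-(φ ⬝ᵥ (Matrix.of P *ᵥ φ)) / 2))
      = fun P => H φ * Real.exp (-(1 / 2 : ℝ) * Q φ P) := by
    funext P; rw [hQ]; ring_nf
  rw [hfun]
  have h1 : HasFDerivAt (fun P : ι → ι → ℝ => -(1 / 2 : ℝ) * Q φ P) ((-(1 / 2 : ℝ)) • Q φ) P :=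
    (Q φ).hasFDerivAt.const_mul _
  have h2 := (h1.exp).const_mul (H φ)
  refine h2.congr_fderiv ?_
  rw [smul_smul, smul_smul, hQ]
  congr 1
  ring_nf

/-- **Differentiation under the integral sign in the matrix variable.** At a coercive `P₀`
(`c Σφᵢ² ≤ φᵀP₀φ`, `c > 0`), for measurable `H` of polynomial growth,
`P ↦ ∫ H(φ) e^{−½ φᵀPφ} dφ` has the Fréchet derivative `∫ (H(φ) e^{−½ φᵀP₀φ} · (−½)) • Q φ dφ`
(dominated differentiation on the sup-norm ball where `φᵀPφ ≥ (c/2) Σφᵢ²`). [folklore] -/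
theorem hasFDerivAt_gaussInt [DecidableEq ι] {c : ℝ} (hc : 0 < c) {P₀ : ι → ι → ℝ}
    (hP₀ : ∀ φ : ι → ℝ, c * ∑ i, φ i ^ 2 ≤ φ ⬝ᵥ (Matrix.of P₀ *ᵥ φ)) {m : ℕ} {K : ℝ}
    {H : (ι → ℝ) → ℝ} (hHm : Measurable H) (hHb : ∀ φ : ι → ℝ, |H φ| ≤ K * (1 + ∑ i, φ i ^ 2) ^ m)
    {Q : (ι → ℝ) → ((ι → ι → ℝ) →L[ℝ] ℝ)} (hQ : ∀ φ P, Q φ P = φ ⬝ᵥ (Matrix.of P *ᵥ φ))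
    (hQn : ∀ φ, ‖Q φ‖ ≤ ∑ a, ∑ b, |φ a| * |φ b|) (hQc : Continuous Q) :
    HasFDerivAt (fun P : ι → ι → ℝ => ∫ φ : ι → ℝ, H φ * Real.exp (-(φ ⬝ᵥ (Matrix.of P *ᵥ φ)) / 2))
      (∫ φ : ι → ℝ, (H φ * Real.exp (-(φ ⬝ᵥ (Matrix.of P₀ *ᵥ φ)) / 2) * (-(1 / 2) : ℝ)) • Q φ) P₀ := by
  have hK : 0 ≤ K := nonneg_of_polyBound hHb
  -- measurability of the integrands
  have hqc : ∀ P : ι → ι → ℝ, Continuous fun φ : ι → ℝ => φ ⬝ᵥ (Matrix.of P *ᵥ φ) := fun P =>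
    continuous_id.dotProduct (Continuous.matrix_mulVec continuous_const continuous_id)
  have hFm : ∀ P : ι → ι → ℝ,
      Measurable fun φ : ι → ℝ => H φ * Real.exp (-(φ ⬝ᵥ (Matrix.of P *ᵥ φ)) / 2) := fun P =>
    hHm.mul ((hqc P).neg.div_const _).rexp.measurable
  -- the dominating function on the ball of radius `r`
  set r : ℝ := c / (2 * ((Fintype.card ι : ℝ) ^ 2 + 1)) with hr
  have hrpos : 0 < r := by positivity
  obtain ⟨-, hform⟩ := smul_one_posDef_and_form (ι := ι) (half_pos hc)
  set G : (ι → ℝ) → ℝ := fun φ => |H φ| * ((1 / 2 : ℝ) * ∑ a, ∑ b, |φ a| * |φ b|) with hG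
  have hGm : Measurable G :=
    hHm.abs.mul (measurable_const.mul (Finset.measurable_sum _ fun a _ =>
      Finset.measurable_sum _ fun b _ => ((measurable_pi_apply a).abs.mul (measurable_pi_apply b).abs)))
  have hGb : ∀ φ : ι → ℝ, |G φ| ≤ K * (Fintype.card ι : ℝ) ^ 2 * (1 + ∑ i, φ i ^ 2) ^ (m + 1) := by
    intro φ
    have h1 := hHb φ
    have h2 := sum_abs_mul_abs_le φ
    have hpos : 0 ≤ 1 + ∑ i, φ i ^ 2 := by positivity
    have hss : 0 ≤ ∑ a, ∑ b, |φ a| * |φ b| :=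
      Finset.sum_nonneg fun a _ => Finset.sum_nonneg fun b _ => by positivity
    rw [hG, abs_mul, abs_abs, abs_of_nonneg (by positivity : (0 : ℝ) ≤ 1 / 2 * _), pow_succ]
    calc |H φ| * (1 / 2 * ∑ a, ∑ b, |φ a| * |φ b|)
        ≤ (K * (1 + ∑ i, φ i ^ 2) ^ m) * (1 * ((Fintype.card ι : ℝ) ^ 2 * (1 + ∑ i, φ i ^ 2))) := by
          refine mul_le_mul h1 ?_ (by positivity) (by positivity)
          exact mul_le_mul (by norm_num) h2 hss zero_le_one
      _ = K * (Fintype.card ι : ℝ) ^ 2 * ((1 + ∑ i, φ i ^ 2) ^ m * (1 + ∑ i, φ i ^ 2)) := by ring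
  have hbound_int : Integrable (fun φ : ι → ℝ =>
      G φ * Real.exp (-(φ ⬝ᵥ (Matrix.of ((c / 2) • (1 : Matrix ι ι ℝ)) *ᵥ φ)) / 2)) :=
    integrable_of_coercive (half_pos hc) (fun φ => (hform φ).symm.le) hGm hGb
  refine hasFDerivAt_integral_of_dominated_of_fderiv_le (𝕜 := ℝ)
    (F' := fun P φ => (H φ * Real.exp (-(φ ⬝ᵥ (Matrix.of P *ᵥ φ)) / 2) * (-(1 / 2) : ℝ)) • Q φ)
    (ball_mem_nhds P₀ hrpos)
    (Filter.Eventually.of_forall fun P => (hFm P).aestronglyMeasurable)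
    (integrable_of_coercive hc hP₀ hHm hHb) ?_ ?_ hbound_int ?_
  · exact ((hFm P₀).mul_const _).aestronglyMeasurable.smul hQc.aestronglyMeasurable
  · refine Filter.Eventually.of_forall fun φ P hP => ?_
    have hcoer := coercive_of_mem_ball hc hP₀ hP φ
    rw [norm_smul, Real.norm_eq_abs, abs_mul, abs_mul, Real.abs_exp,
      abs_of_nonpos (by norm_num : (-(1 / 2) : ℝ) ≤ 0), neg_neg, hG]
    calc |H φ| * Real.exp (-(φ ⬝ᵥ (Matrix.of P *ᵥ φ)) / 2) * (1 / 2) * ‖Q φ‖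
        ≤ |H φ| * Real.exp (-(φ ⬝ᵥ (Matrix.of ((c / 2) • (1 : Matrix ι ι ℝ)) *ᵥ φ)) / 2)
            * (1 / 2) * ∑ a, ∑ b, |φ a| * |φ b| := by
          refine mul_le_mul (mul_le_mul_of_nonneg_right (mul_le_mul_of_nonneg_left
            (Real.exp_le_exp.2 ?_) (abs_nonneg _)) (by norm_num)) (hQn φ) (norm_nonneg _)
            (by positivity)
          have hof : Matrix.of ((c / 2) • (1 : Matrix ι ι ℝ)) = (c / 2) • (1 : Matrix ι ι ℝ) := rfl
          rw [hof, hform, neg_div, neg_div, neg_le_neg_iff]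
          exact div_le_div_of_nonneg_right hcoer (by norm_num)
      _ = |H φ| * (1 / 2 * ∑ a, ∑ b, |φ a| * |φ b|)
            * Real.exp (-(φ ⬝ᵥ (Matrix.of ((c / 2) • (1 : Matrix ι ι ℝ)) *ᵥ φ)) / 2) := by ring
  · exact Filter.Eventually.of_forall fun φ P _ => hasFDerivAt_integrand hQ H φ P

end GaussSmooth

end Summit.QuantumFields.YangMills.Theorems.AnchorGap
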